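import Summits.AnomalousDissipation.AnomalousDissipation.Theorems.MomentParityQuarticGateRows
import Summits.AnomalousDissipation.AnomalousDissipation.Theorems.MomentParityQuarticGateCoords
import Literature.Analysis.FunctionSpaces.TorusHolderSobolevEmbedding

/-!
# Order-3 surgery for `MomentParity.QuarticGate` (stmt-AnomalousDissipation-11464), line
# `axis-sectors`, stub `stub_order3SurgerySym` (S5b), helper II: translations and shear matrices

Bookkeeping for the shear symmetry of the line `axis-sectors` (namespace `Order3Sym`).

Torus side: translates `x ↦ w (x + a)` of test fields and the covariance of the Navier–Stokes
generator pairing under them —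
* `fderiv_translate`, `laplacian_translate`, `divergence_translate` (the charts `liftAt` are
  translation-equivariant), `isBandTest_translate` (a translate of a band test is a band test:
  `IsSmooth.comp_add_right`, invariance of the Haar measure, `mFourierCoeff_comp_add_right`);
* `pairing_translate`, `nsGeneratorPairing_translate`, `nsGeneratorPairing_polyGrad_translate` —
  **covariance**: if `u' = u(· − a)` a.e. and the force is `a`-invariant then
  `(u, w(·+a)) = (u', w)` and `⟨F(u), w(·+a)⟩ = ⟨F(u'), w⟩` (change of variables on `T³`);
* `pairing_sum_smul`; `finite_shearGroup` — `H_L = {a | a 1 = 0, L • a = 0}` is finite.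

Basis side: for an orthonormal band basis `b` (bundle `hb`, `hbo`, `hbs` of `exists_bandBasis`)
the band space is translation invariant, and `b_k(· + a)` expands with the SHEAR MATRIX
`M(a)_{ki} = ∫ ⟪b_k(y + a), b_i(y)⟫ dy` (a hypothesis `hM` on an abstract family `M`) —
* `translate_basis_eq_sum`, `pairing_translate_basis`; `shearMatrix_add`, `shearMatrix_zero`
  (`M(a + a') = M(a') M(a)`, `M(0) = 1`); `exists_translate_level` (the translate of a level-`N`
  field is level-`N` with coordinates `M(a) x`);
* `rowPoly_translate` — **row polynomials are closed under shear matrices** (summary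
  `order3Sym_rowPoly_translate`); `integral_eval_shear_eq` — coordinate moments of a law with
  `a`-invariant statistics are `M(a)`-invariant; `coords_translate_family`.
-/

-- `Summit.<Summit>.<Problem>` is the tree's mandated summit-side namespace (CONVENTIONS §2); for this
-- single-conjunct summit the two coincide, so the duplicate is deliberate.
set_option linter.dupNamespace false

namespace Summit.AnomalousDissipation.AnomalousDissipation.Theorems.MomentParityQuarticGate

namespace Order3Sym

open scoped BigOperators InnerProductSpace RealInnerProductSpace ENNReal
open MeasureTheory Filter MvPolynomial
open Literature.Analysis.FunctionSpaces Literature.Analysis.FluidPDE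
open Summit.AnomalousDissipation.AnomalousDissipation.Theorems.QuarticGate.Negative

/-! ## Derivatives of translates -/

/-- The chart of a translate is the translated chart: `liftAt (w(·+a)) x = liftAt w (x + a)`.
[folklore] -/
theorem liftAt_translate {F : Type*} (w : UnitAddTorus (Fin 3) → F) (a x : UnitAddTorus (Fin 3)) :
    Torus.liftAt (fun y => w (y + a)) x = Torus.liftAt w (x + a) := by
  funext v
  simp only [Torus.liftAt_apply, add_right_comm x _ a]

/-- `D(w(·+a))(x) = Dw(x + a)`. [folklore] -/
theorem fderiv_translate {F : Type*} [NormedAddCommGroup F] [NormedSpace ℝ F]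
    (w : UnitAddTorus (Fin 3) → F) (a x : UnitAddTorus (Fin 3)) :
    Torus.fderiv (fun y => w (y + a)) x = Torus.fderiv w (x + a) := by
  unfold Torus.fderiv
  rw [liftAt_translate]

/-- `Δ(w(·+a))(x) = Δw(x + a)`. [folklore] -/
theorem laplacian_translate {F : Type*} [NormedAddCommGroup F] [InnerProductSpace ℝ F]
    (w : UnitAddTorus (Fin 3) → F) (a x : UnitAddTorus (Fin 3)) :
    Torus.laplacian (fun y => w (y + a)) x = Torus.laplacian w (x + a) := by
  unfold Torus.laplacian
  rw [liftAt_translate]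

/-- `∂ᵢ(G(·+a))(x) = ∂ᵢG(x + a)`. [folklore] -/
theorem partialDeriv_translate {F : Type*} [NormedAddCommGroup F] [NormedSpace ℝ F]
    (G : UnitAddTorus (Fin 3) → F) (i : Fin 3) (a x : UnitAddTorus (Fin 3)) :
    Torus.partialDeriv i (fun y => G (y + a)) x = Torus.partialDeriv i G (x + a) := by
  unfold Torus.partialDeriv Torus.lineDeriv
  simp only [add_right_comm x _ a]

/-- `div(g(·+a))(x) = div g (x + a)`. [folklore] -/
theorem divergence_translate (g : UnitAddTorus (Fin 3) → EuclideanSpace ℝ (Fin 3))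
    (a x : UnitAddTorus (Fin 3)) :
    Torus.divergence (fun y => g (y + a)) x = Torus.divergence g (x + a) := by
  unfold Torus.divergence
  exact Finset.sum_congr rfl fun i _ => partialDeriv_translate (fun y => g y i) i a x

/-! ## Translates of band tests -/

/-- **A translate of a level-`N` band test is a level-`N` band test.** [folklore] -/
theorem isBandTest_translate {N : ℕ} {g : UnitAddTorus (Fin 3) → EuclideanSpace ℝ (Fin 3)}
    (hg : IsBandTest N g) (a : UnitAddTorus (Fin 3)) : IsBandTest N (fun y => g (y + a)) := by
  obtain ⟨hs, hd, hz, hband⟩ := hg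
  refine ⟨hs.comp_add_right a, fun x => ?_, ?_, fun k hk => ?_⟩
  · rw [divergence_translate, hd]
  · unfold Torus.HasZeroMean at hz ⊢
    rw [integral_add_right_eq_self g a, hz]
  · have h := Torus.mFourierCoeff_comp_add_right (EuclideanSpace.complexify ∘ g) a k
    rw [hband k hk, smul_zero] at h
    exact h

/-! ## Covariance of pairings under translation -/

/-- **Covariance of the pairing**: `(u, w(·+a)) = (u', w)` when `u' = u(· − a)` a.e. [folklore] -/
theorem pairing_translate (u u' : Torus.energySpace (Fin 3)) (a : UnitAddTorus (Fin 3))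
    (hu' : ((u'.1 : Lp (EuclideanSpace ℝ (Fin 3)) 2 (volume : Measure (UnitAddTorus (Fin 3)))) :
        UnitAddTorus (Fin 3) → EuclideanSpace ℝ (Fin 3)) =ᵐ[volume]
      fun z => ((u.1 : Lp (EuclideanSpace ℝ (Fin 3)) 2 (volume : Measure (UnitAddTorus (Fin 3)))) :
        UnitAddTorus (Fin 3) → EuclideanSpace ℝ (Fin 3)) (z - a))
    (w : UnitAddTorus (Fin 3) → EuclideanSpace ℝ (Fin 3)) :
    Torus.pairing u.1 (fun y => w (y + a)) = Torus.pairing u'.1 w := by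
  unfold Torus.pairing
  rw [integral_congr_ae (hu'.mono fun z hz => by simp only [hz] :
      (fun z => ⟪((u'.1 : Lp (EuclideanSpace ℝ (Fin 3)) 2 (volume : Measure (UnitAddTorus (Fin 3)))) :
          UnitAddTorus (Fin 3) → EuclideanSpace ℝ (Fin 3)) z, w z⟫_ℝ) =ᵐ[volume]
        fun z => ⟪((u.1 : Lp (EuclideanSpace ℝ (Fin 3)) 2 (volume : Measure (UnitAddTorus (Fin 3)))) :
          UnitAddTorus (Fin 3) → EuclideanSpace ℝ (Fin 3)) (z - a), w z⟫_ℝ),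
    ← integral_add_right_eq_self (fun z =>
      ⟪((u.1 : Lp (EuclideanSpace ℝ (Fin 3)) 2 (volume : Measure (UnitAddTorus (Fin 3)))) :
        UnitAddTorus (Fin 3) → EuclideanSpace ℝ (Fin 3)) (z - a), w z⟫_ℝ) a]
  simp only [add_sub_cancel_right]

/-- **Covariance of the generator pairing under translation.** If the force is invariant under
the translation `a` and `u' = u(· − a)` a.e., then `⟨F(u), w(·+a)⟩ = ⟨F(u'), w⟩`: each of the three
summands (force, viscous, inertial) is a change of variables `x ↦ x + a` on `T³` after moving the
derivative through the translation. [folklore] -/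
theorem nsGeneratorPairing_translate (ν : ℝ) {f : UnitAddTorus (Fin 3) → EuclideanSpace ℝ (Fin 3)}
    (a : UnitAddTorus (Fin 3)) (hfa : ∀ x, f (x + a) = f x) (u u' : Torus.energySpace (Fin 3))
    (hu' : ((u'.1 : Lp (EuclideanSpace ℝ (Fin 3)) 2 (volume : Measure (UnitAddTorus (Fin 3)))) :
        UnitAddTorus (Fin 3) → EuclideanSpace ℝ (Fin 3)) =ᵐ[volume]
      fun z => ((u.1 : Lp (EuclideanSpace ℝ (Fin 3)) 2 (volume : Measure (UnitAddTorus (Fin 3)))) :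
        UnitAddTorus (Fin 3) → EuclideanSpace ℝ (Fin 3)) (z - a))
    (w : UnitAddTorus (Fin 3) → EuclideanSpace ℝ (Fin 3)) :
    Torus.nsGeneratorPairing ν f u (fun y => w (y + a)) = Torus.nsGeneratorPairing ν f u' w := by
  set U : UnitAddTorus (Fin 3) → EuclideanSpace ℝ (Fin 3) :=
    ((u.1 : Lp (EuclideanSpace ℝ (Fin 3)) 2 (volume : Measure (UnitAddTorus (Fin 3)))) :
      UnitAddTorus (Fin 3) → EuclideanSpace ℝ (Fin 3)) with hU
  set U' : UnitAddTorus (Fin 3) → EuclideanSpace ℝ (Fin 3) :=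
    ((u'.1 : Lp (EuclideanSpace ℝ (Fin 3)) 2 (volume : Measure (UnitAddTorus (Fin 3)))) :
      UnitAddTorus (Fin 3) → EuclideanSpace ℝ (Fin 3)) with hU'
  -- force term
  have hforce : ∫ x, ⟪f x, w (x + a)⟫_ℝ = ∫ x, ⟪f x, w x⟫_ℝ := by
    calc ∫ x, ⟪f x, w (x + a)⟫_ℝ = ∫ x, ⟪f (x + a), w (x + a)⟫_ℝ := by simp_rw [hfa]
      _ = ∫ x, ⟪f x, w x⟫_ℝ := integral_add_right_eq_self (fun x => ⟪f x, w x⟫_ℝ) a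
  -- viscous term
  have hvisc : ∫ x, ⟪U x, Torus.laplacian (fun y => w (y + a)) x⟫_ℝ =
      ∫ x, ⟪U' x, Torus.laplacian w x⟫_ℝ := by
    simp_rw [laplacian_translate]
    rw [integral_congr_ae (hu'.mono fun z hz => by simp only [hz] :
        (fun z => ⟪U' z, Torus.laplacian w z⟫_ℝ) =ᵐ[volume]
          fun z => ⟪U (z - a), Torus.laplacian w z⟫_ℝ),
      ← integral_add_right_eq_self (fun z => ⟪U (z - a), Torus.laplacian w z⟫_ℝ) a]
    simp only [add_sub_cancel_right]
  -- inertial term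
  have hinert : ∫ x, ⟪Torus.fderiv (fun y => w (y + a)) x (U x), U x⟫_ℝ =
      ∫ x, ⟪Torus.fderiv w x (U' x), U' x⟫_ℝ := by
    simp_rw [fderiv_translate]
    rw [integral_congr_ae (hu'.mono fun z hz => by simp only [hz] :
        (fun z => ⟪Torus.fderiv w z (U' z), U' z⟫_ℝ) =ᵐ[volume]
          fun z => ⟪Torus.fderiv w z (U (z - a)), U (z - a)⟫_ℝ),
      ← integral_add_right_eq_self (fun z => ⟪Torus.fderiv w z (U (z - a)), U (z - a)⟫_ℝ) a]
    simp only [add_sub_cancel_right]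
  unfold Torus.nsGeneratorPairing Torus.inertialPairing
  rw [hforce, hvisc, hinert]

/-- **Translated polynomial tests**: if `u' = u(· − a)` a.e. then the differential field of the
test `(g(·+a), P)` at `u` is the translate of that of `(g, P)` at `u'`. [folklore] -/
theorem polyGrad_translate {m : ℕ} (g : Fin m → UnitAddTorus (Fin 3) → EuclideanSpace ℝ (Fin 3))
    (P : MvPolynomial (Fin m) ℝ) (u u' : Torus.energySpace (Fin 3)) (a : UnitAddTorus (Fin 3))
    (hu' : ((u'.1 : Lp (EuclideanSpace ℝ (Fin 3)) 2 (volume : Measure (UnitAddTorus (Fin 3)))) :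
        UnitAddTorus (Fin 3) → EuclideanSpace ℝ (Fin 3)) =ᵐ[volume]
      fun z => ((u.1 : Lp (EuclideanSpace ℝ (Fin 3)) 2 (volume : Measure (UnitAddTorus (Fin 3)))) :
        UnitAddTorus (Fin 3) → EuclideanSpace ℝ (Fin 3)) (z - a)) :
    polyGrad (fun k y => g k (y + a)) P u = fun x => polyGrad g P u' (x + a) := by
  funext x
  unfold polyGrad
  have hco : (fun j => Torus.pairing u.1 (fun y => g j (y + a))) = fun j => Torus.pairing u'.1 (g j) :=
    funext fun j => pairing_translate u u' a hu' (g j)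
  rw [hco]

/-- **Covariance of the row integrand**: with `f` invariant under `a` and `u' = u(· − a)` a.e.,
the row integrand of the translated test `(g(·+a), P)` at `u` is that of `(g, P)` at `u'`.
[folklore] -/
theorem nsGeneratorPairing_polyGrad_translate (ν : ℝ)
    {f : UnitAddTorus (Fin 3) → EuclideanSpace ℝ (Fin 3)} (a : UnitAddTorus (Fin 3))
    (hfa : ∀ x, f (x + a) = f x) {m : ℕ}
    (g : Fin m → UnitAddTorus (Fin 3) → EuclideanSpace ℝ (Fin 3)) (P : MvPolynomial (Fin m) ℝ)
    (u u' : Torus.energySpace (Fin 3))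
    (hu' : ((u'.1 : Lp (EuclideanSpace ℝ (Fin 3)) 2 (volume : Measure (UnitAddTorus (Fin 3)))) :
        UnitAddTorus (Fin 3) → EuclideanSpace ℝ (Fin 3)) =ᵐ[volume]
      fun z => ((u.1 : Lp (EuclideanSpace ℝ (Fin 3)) 2 (volume : Measure (UnitAddTorus (Fin 3)))) :
        UnitAddTorus (Fin 3) → EuclideanSpace ℝ (Fin 3)) (z - a)) :
    Torus.nsGeneratorPairing ν f u (polyGrad (fun k y => g k (y + a)) P u) =
      Torus.nsGeneratorPairing ν f u' (polyGrad g P u') := by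
  rw [polyGrad_translate g P u u' a hu']
  exact nsGeneratorPairing_translate ν a hfa u u' hu' (polyGrad g P u')

/-! ## Linearity of the pairing in the test field -/

/-- The pairing of `u ∈ H` is linear in a continuous test field:
`(u, Σ_k c_k h_k) = Σ_k c_k (u, h_k)`. [folklore] -/
theorem pairing_sum_smul {ι : Type*} (s : Finset ι) (c : ι → ℝ)
    {h : ι → UnitAddTorus (Fin 3) → EuclideanSpace ℝ (Fin 3)} (hh : ∀ k, Continuous (h k))
    (u : Torus.energySpace (Fin 3)) :
    Torus.pairing u.1 (fun y => ∑ k ∈ s, c k • h k y) = ∑ k ∈ s, c k * Torus.pairing u.1 (h k) := by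
  have hint : ∀ k, Integrable (fun y =>
      ⟪((u.1 : Lp (EuclideanSpace ℝ (Fin 3)) 2 (volume : Measure (UnitAddTorus (Fin 3)))) :
        UnitAddTorus (Fin 3) → EuclideanSpace ℝ (Fin 3)) y, h k y⟫_ℝ) volume := fun k =>
    Torus.integrable_inner_of_continuous ((Lp.memLp u.1).integrable one_le_two) (hh k)
  unfold Torus.pairing
  simp_rw [inner_sum, real_inner_smul_right]
  rw [integral_finsetSum _ fun k _ => (hint k).const_mul _]
  simp_rw [integral_const_mul]

/-! ## The finite shear group -/

/-- **The shear group `H_L = {a : T³ | a 1 = 0, L • a = 0}` is finite** for `0 < L` (each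
coordinate is `L`-torsion in `ℝ/ℤ`). [folklore] -/
theorem finite_shearGroup (L : ℕ) (hL : 0 < L) :
    {a : UnitAddTorus (Fin 3) | a 1 = 0 ∧ L • a = 0}.Finite := by
  have h1 : {x : UnitAddCircle | L • x = 0}.Finite := AddCircle.finite_torsion (1 : ℝ) hL
  refine (Set.Finite.pi (ι := Fin 3) (t := fun _ => {x : UnitAddCircle | L • x = 0})
    (fun _ => h1)).subset fun a ha => ?_
  simp only [Set.mem_pi, Set.mem_univ, Set.mem_setOf_eq, forall_true_left]
  intro i
  have := congr_fun ha.2 i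
  simpa using this




variable {N n : ℕ} {b : Fin n → UnitAddTorus (Fin 3) → EuclideanSpace ℝ (Fin 3)}
  {M : UnitAddTorus (Fin 3) → Matrix (Fin n) (Fin n) ℝ}

/-! ## Expansion of translated basis fields -/

/-- **`b_k(· + a) = Σ_i M(a)_{ki} b_i`** pointwise. [folklore] -/
theorem translate_basis_eq_sum (hb : ∀ i, IsBandTest N (b i))
    (hbs : ∀ u : Torus.energySpace (Fin 3), IsLevel N u →
      ∀ x, Torus.fourierTruncate N (u.1 : UnitAddTorus (Fin 3) → EuclideanSpace ℝ (Fin 3)) x =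
        ∑ i, Torus.pairing u.1 (b i) • b i x)
    (hM : ∀ a k i, M a k i = ∫ y, ⟪b k (y + a), b i y⟫_ℝ) (a : UnitAddTorus (Fin 3)) (k : Fin n)
    (x : UnitAddTorus (Fin 3)) : b k (x + a) = ∑ i, M a k i • b i x := by
  simp_rw [hM]
  exact band_eq_sum_smul hbs (isBandTest_translate (hb k) a) x

/-- **`(u, b_k(· + a)) = Σ_i M(a)_{ki} (u, b_i)`** for every `u ∈ H`. [folklore] -/
theorem pairing_translate_basis (hb : ∀ i, IsBandTest N (b i))
    (hbs : ∀ u : Torus.energySpace (Fin 3), IsLevel N u →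
      ∀ x, Torus.fourierTruncate N (u.1 : UnitAddTorus (Fin 3) → EuclideanSpace ℝ (Fin 3)) x =
        ∑ i, Torus.pairing u.1 (b i) • b i x)
    (hM : ∀ a k i, M a k i = ∫ y, ⟪b k (y + a), b i y⟫_ℝ) (u : Torus.energySpace (Fin 3))
    (a : UnitAddTorus (Fin 3)) (k : Fin n) :
    Torus.pairing u.1 (fun y => b k (y + a)) = ∑ i, M a k i * Torus.pairing u.1 (b i) := by
  simp_rw [hM]
  exact pairing_band_eq_sum hb hbs (isBandTest_translate (hb k) a) u

/-! ## The representation property -/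

/-- **`M(a + a') = M(a') M(a)`.** [folklore] -/
theorem shearMatrix_add (hb : ∀ i, IsBandTest N (b i))
    (hbo : ∀ i j, ∫ x, ⟪b i x, b j x⟫_ℝ = if i = j then (1 : ℝ) else 0)
    (hbs : ∀ u : Torus.energySpace (Fin 3), IsLevel N u →
      ∀ x, Torus.fourierTruncate N (u.1 : UnitAddTorus (Fin 3) → EuclideanSpace ℝ (Fin 3)) x =
        ∑ i, Torus.pairing u.1 (b i) • b i x)
    (hM : ∀ a k i, M a k i = ∫ y, ⟪b k (y + a), b i y⟫_ℝ) (a a' : UnitAddTorus (Fin 3)) :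
    M (a + a') = M a' * M a := by
  ext k j
  rw [Matrix.mul_apply, hM]
  have hexp : ∀ y, b k (y + (a + a')) = ∑ j', (∑ i, M a' k i * M a i j') • b j' y := by
    intro y
    rw [← add_assoc, translate_basis_eq_sum hb hbs hM a' k (y + a)]
    simp_rw [translate_basis_eq_sum hb hbs hM a _ y, Finset.smul_sum, smul_smul, Finset.sum_smul]
    rw [Finset.sum_comm]
  simp_rw [hexp]
  exact integral_inner_sum_smul_left hb hbo _ j

/-- **`M(0) = 1`.** [folklore] -/
theorem shearMatrix_zero (hbo : ∀ i j, ∫ x, ⟪b i x, b j x⟫_ℝ = if i = j then (1 : ℝ) else 0)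
    (hM : ∀ a k i, M a k i = ∫ y, ⟪b k (y + a), b i y⟫_ℝ) : M 0 = 1 := by
  ext k i
  rw [hM, Matrix.one_apply]
  simp_rw [add_zero]
  exact hbo k i

/-! ## Translates of level-`N` fields -/

/-- **The translate `u(· − a)` of a level-`N` field is a level-`N` field with coordinates
`M(a) x`.** [folklore] -/
theorem exists_translate_level (hb : ∀ i, IsBandTest N (b i))
    (hbs : ∀ u : Torus.energySpace (Fin 3), IsLevel N u →
      ∀ x, Torus.fourierTruncate N (u.1 : UnitAddTorus (Fin 3) → EuclideanSpace ℝ (Fin 3)) x =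
        ∑ i, Torus.pairing u.1 (b i) • b i x)
    (hM : ∀ a k i, M a k i = ∫ y, ⟪b k (y + a), b i y⟫_ℝ) (u : Torus.energySpace (Fin 3))
    (hu : IsLevel N u) (a : UnitAddTorus (Fin 3)) :
    ∃ u' : Torus.energySpace (Fin 3), IsLevel N u' ∧
      (((u'.1 : Lp (EuclideanSpace ℝ (Fin 3)) 2 (volume : Measure (UnitAddTorus (Fin 3)))) :
          UnitAddTorus (Fin 3) → EuclideanSpace ℝ (Fin 3)) =ᵐ[volume]
        fun z => ((u.1 : Lp (EuclideanSpace ℝ (Fin 3)) 2 (volume : Measure (UnitAddTorus (Fin 3)))) :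
          UnitAddTorus (Fin 3) → EuclideanSpace ℝ (Fin 3)) (z - a)) ∧
      (fun k => Torus.pairing u'.1 (b k)) = fun k => ∑ i, M a k i * Torus.pairing u.1 (b i) := by
  set x : Fin n → ℝ := fun i => Torus.pairing u.1 (b i) with hx
  have hv : IsBandTest N (fun y => ∑ i, x i • b i y) := sum_smul_band Finset.univ x hb
  have hva : IsBandTest N (fun z => ∑ i, x i • b i (z - a)) := by
    have h := isBandTest_translate hv (-a)
    simp only [← sub_eq_add_neg] at h
    exact h
  obtain ⟨U, hU⟩ := exists_energySpace_coe_ae_eq hva.1 hva.2.1 hva.2.2.1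
  have h1 : (fun z => ((u.1 : Lp (EuclideanSpace ℝ (Fin 3)) 2 (volume : Measure (UnitAddTorus (Fin 3)))) :
      UnitAddTorus (Fin 3) → EuclideanSpace ℝ (Fin 3)) (z - a)) =ᵐ[volume]
      fun z => ∑ i, x i • b i (z - a) :=
    (measurePreserving_sub_right volume a).quasiMeasurePreserving.ae_eq_comp
      (coe_ae_eq_sum_of_level hbs u hu)
  have hae := hU.trans h1.symm
  refine ⟨U, level_of_coe_ae_eq hU hva.2.2.2, hae, funext fun k => ?_⟩
  rw [← pairing_translate u U a hae (b k), pairing_translate_basis hb hbs hM u a k]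

/-! ## Row polynomials are closed under the shear matrices -/

/-- **Row polynomials are closed under shear matrices.** If `Q` computes the row of the test
`(b, P)` on level-`N` fields for a force invariant under the translation `a`, then the substituted
polynomial `Q ∘ M(a)` computes the row of the (transported translated) test `(b, P ∘ M(a))`.
[folklore] -/
theorem rowPoly_translate (hb : ∀ i, IsBandTest N (b i))
    (hbs : ∀ u : Torus.energySpace (Fin 3), IsLevel N u →
      ∀ x, Torus.fourierTruncate N (u.1 : UnitAddTorus (Fin 3) → EuclideanSpace ℝ (Fin 3)) x =
        ∑ i, Torus.pairing u.1 (b i) • b i x)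
    (hM : ∀ a k i, M a k i = ∫ y, ⟪b k (y + a), b i y⟫_ℝ) (ν : ℝ)
    {f : UnitAddTorus (Fin 3) → EuclideanSpace ℝ (Fin 3)} (a : UnitAddTorus (Fin 3))
    (hfa : ∀ x, f (x + a) = f x) (P Q : MvPolynomial (Fin n) ℝ)
    (hQ : ∀ u : Torus.energySpace (Fin 3), IsLevel N u →
      Torus.nsGeneratorPairing ν f u (polyGrad b P u) = eval (fun i => Torus.pairing u.1 (b i)) Q)
    (u : Torus.energySpace (Fin 3)) (hu : IsLevel N u) :
    Torus.nsGeneratorPairing ν f u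
        (polyGrad b (bind₁ (fun k => ∑ i, C (M a k i) * (X i : MvPolynomial (Fin n) ℝ)) P) u) =
      eval (fun i => Torus.pairing u.1 (b i))
        (bind₁ (fun k => ∑ i, C (M a k i) * (X i : MvPolynomial (Fin n) ℝ)) Q) := by
  obtain ⟨u', hu', hae, hco⟩ := exists_translate_level hb hbs hM u hu a
  have htr : polyGrad b (bind₁ (fun k => ∑ i, C (M a k i) * (X i : MvPolynomial (Fin n) ℝ)) P) u =
      polyGrad (fun k y => b k (y + a)) P u :=
    funext fun x => (polyGrad_transport (M a) (fun k x => translate_basis_eq_sum hb hbs hM a k x)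
      (fun u k => pairing_translate_basis hb hbs hM u a k) P u x).symm
  rw [htr, nsGeneratorPairing_polyGrad_translate ν a hfa b P u u' hae, hQ u' hu', eval_bind₁_linear,
    hco]

/-! ## Invariant laws have invariant coordinate moments -/

/-- **Coordinate moments of a shear-invariant law are `M(a)`-invariant**: if the cylindrical
statistics of `μ` over the basis are invariant under the translation `a`, then
`∫ Q(M(a) x(u)) dμ = ∫ Q(x(u)) dμ` for every polynomial `Q`. [folklore] -/
theorem integral_eval_shear_eq (hb : ∀ i, IsBandTest N (b i))
    (hbs : ∀ u : Torus.energySpace (Fin 3), IsLevel N u →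
      ∀ x, Torus.fourierTruncate N (u.1 : UnitAddTorus (Fin 3) → EuclideanSpace ℝ (Fin 3)) x =
        ∑ i, Torus.pairing u.1 (b i) • b i x)
    (hM : ∀ a k i, M a k i = ∫ y, ⟪b k (y + a), b i y⟫_ℝ) (μ : Measure (Torus.energySpace (Fin 3)))
    (a : UnitAddTorus (Fin 3))
    (hsym : Measure.map (fun u : Torus.energySpace (Fin 3) => fun i =>
        Torus.pairing u.1 (fun y => b i (y + a))) μ =
      Measure.map (fun u : Torus.energySpace (Fin 3) => fun i => Torus.pairing u.1 (b i)) μ)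
    (Q : MvPolynomial (Fin n) ℝ) :
    ∫ u, eval (fun k => ∑ i, M a k i * Torus.pairing u.1 (b i)) Q ∂μ =
      ∫ u, eval (fun i => Torus.pairing u.1 (b i)) Q ∂μ := by
  have hba : ∀ i, IsBandTest N (fun y => b i (y + a)) := fun i => isBandTest_translate (hb i) a
  simp_rw [← pairing_translate_basis hb hbs hM _ a]
  rw [← integral_map (continuous_coords hba).aemeasurable (continuous_eval Q).aestronglyMeasurable,
    hsym, integral_map (continuous_coords hb).aemeasurable (continuous_eval Q).aestronglyMeasurable]

/-! ## Coordinates of a translated band family -/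

/-- **Coordinates of a translated band family.** If `U` has coordinates `x` and `U'` has
coordinates `M(a) x`, then `((U, gᵢ(· + a)))ᵢ = ((U', gᵢ))ᵢ` for every family of band tests `g`.
[folklore] -/
theorem coords_translate_family (hb : ∀ i, IsBandTest N (b i))
    (hbs : ∀ u : Torus.energySpace (Fin 3), IsLevel N u →
      ∀ x, Torus.fourierTruncate N (u.1 : UnitAddTorus (Fin 3) → EuclideanSpace ℝ (Fin 3)) x =
        ∑ i, Torus.pairing u.1 (b i) • b i x)
    (hM : ∀ a k i, M a k i = ∫ y, ⟪b k (y + a), b i y⟫_ℝ) {m : ℕ}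
    {g : Fin m → UnitAddTorus (Fin 3) → EuclideanSpace ℝ (Fin 3)} (hg : ∀ i, IsBandTest N (g i))
    (a : UnitAddTorus (Fin 3)) (U U' : Torus.energySpace (Fin 3)) (x : Fin n → ℝ)
    (hU : ∀ i, Torus.pairing U.1 (b i) = x i)
    (hU' : ∀ k, Torus.pairing U'.1 (b k) = ∑ i, M a k i * x i) :
    (fun i => Torus.pairing U.1 (fun y => g i (y + a))) = fun i => Torus.pairing U'.1 (g i) := by
  funext i
  have hgi : (fun y => g i (y + a)) = fun y => ∑ k, (∫ z, ⟪g i z, b k z⟫_ℝ) • b k (y + a) :=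
    funext fun y => band_eq_sum_smul hbs (hg i) (y + a)
  rw [hgi, pairing_sum_smul Finset.univ _ (fun k => ((hb k).1.comp_add_right a).continuous) U,
    pairing_band_eq_sum hb hbs (hg i) U']
  simp_rw [pairing_translate_basis hb hbs hM U a, hU, hU']

end Order3Sym

open scoped InnerProductSpace RealInnerProductSpace in
open MeasureTheory MvPolynomial Literature.Analysis.FunctionSpaces Literature.Analysis.FluidPDE Summit.AnomalousDissipation.AnomalousDissipation.Theorems.QuarticGate.Negative in
/-- **Registered sub-goal of stub S5b (summary of this file): row polynomials are closed under the shear matrices of a band basis.** [folklore] -/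
theorem order3Sym_rowPoly_translate : ∀ {N n : ℕ} {b : Fin n → UnitAddTorus (Fin 3) → EuclideanSpace ℝ (Fin 3)} {M : UnitAddTorus (Fin 3) → Matrix (Fin n) (Fin n) ℝ}, (∀ i, IsBandTest N (b i)) → (∀ u : Torus.energySpace (Fin 3), IsLevel N u → ∀ x, Torus.fourierTruncate N (u.1 : UnitAddTorus (Fin 3) → EuclideanSpace ℝ (Fin 3)) x = ∑ i, Torus.pairing u.1 (b i) • b i x) → (∀ a k i, M a k i = ∫ y, ⟪b k (y + a), b i y⟫_ℝ) → ∀ (ν : ℝ) {f : UnitAddTorus (Fin 3) → EuclideanSpace ℝ (Fin 3)} (a : UnitAddTorus (Fin 3)), (∀ x, f (x + a) = f x) → ∀ (P Q : MvPolynomial (Fin n) ℝ), (∀ u : Torus.energySpace (Fin 3), IsLevel N u → Torus.nsGeneratorPairing ν f u (polyGrad b P u) = MvPolynomial.eval (fun i => Torus.pairing u.1 (b i)) Q) → ∀ u : Torus.energySpace (Fin 3), IsLevel N u → Torus.nsGeneratorPairing ν f u (polyGrad b (MvPolynomial.bind₁ (fun k => ∑ i, MvPolynomial.C (M a k i) *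 (MvPolynomial.X i : MvPolynomial (Fin n) ℝ)) P) u) = MvPolynomial.eval (fun i => Torus.pairing u.1 (b i)) (MvPolynomial.bind₁ (fun k => ∑ i, MvPolynomial.C (M a k i) * (MvPolynomial.X i : MvPolynomial (Fin n) ℝ)) Q) :=
  fun hb hbs hM ν _ a hfa P Q hQ u hu => Order3Sym.rowPoly_translate hb hbs hM ν a hfa P Q hQ u hu

end Summit.AnomalousDissipation.AnomalousDissipation.Theorems.MomentParityQuarticGate
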